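import Summits.CriticalPhenomena.PercolationContinuityZ3.Theorems.PercNearOneGluingNoHeavyLowerTailKnQuestion8CoefficientwiseCoreClassKernelMixDecor
import HarnessLib

/-!
# THEOREM KB-DECOR, packaged: all levels, from a domination map, and CW-PA on the core class over a decorated middle graph

Support file (`--supports stmt-CriticalPhenomena-4575`, closed), prover `prim-cplus-coupling` (gen 35).  No definitions, no notations, no named facts,
no sorries; standard axioms.  Memo `prim-cplus-coupling/A5-COUPLING-gen35.md` §1.  Wrappers around `…CoreClassKernelMixDecor`.

Setting as there: `E, D` disjoint edge sets whose edges share no vertex other than `v` (a decoration `D` glued at `v`), terminals `a, b` not on `D`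
except possibly as `v`.
* `Coefficientwise.coreClass_kernelMixFull_decor_allLevels` — KB-MIX-FULL of `(E; a, b)` for ALL monotone test functions and levels implies
  KB-MIX-FULL of `(E ∪ D; a, b)` for all of them (the glued functions are again admissible levels).
* `Coefficientwise.coreClass_kernel_nonneg_decor_of_dom` — hence, from ANY domination map of `(E; a, b)`, the core-class kernel of `(E ∪ D; a, b)`
  is nonnegative for every monotone `f` with `f ∅ = 0` and monotone `g` — although `(E ∪ D; a, b)` itself need not have a domination map
  (DOM fails for decorated graphs, memo gen 30 §0(4): `K_{1,4}`; gen 35: subcubic trees on 8 vertices).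
* `Coefficientwise.cwpa_coreClass_of_dom_decor` — **CW-PA (all monotone `f, g`) on the core class `N(x) = N(z) = {a, b}` over any middle graph
  `H ∨_v D` = (middle graph with a domination map) with an arbitrary graph glued at one vertex.**
[cite: KozmaNitzan2024, Questions 8–9 (§5.5 p. 36) (context: the Question-8 pocket covariance programme)]
-/

namespace Summit.CriticalPhenomena.PercolationContinuityZ3.Theorems

open Finset Literature.Probability.Percolation

namespace Coefficientwise

variable {ι V : Type*}

/-- Gluing a fixed set `X` behind the vertex `v` is monotone in the argument. [cite: KozmaNitzan2024, §5.5 (context only; elementary)] -/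
theorem glue_mono (v : V) (X : Set V) : Monotone (fun Y : Set V => Y ∪ {w | v ∈ Y ∧ w ∈ X}) := by
  intro Y Y' hle w hw
  rcases hw with hw | ⟨hv, hw⟩
  · exact Or.inl (hle hw)
  · exact Or.inr ⟨hle hv, hw⟩

open Classical in
/-- **KB-DECOR, all levels.**  If KB-MIX-FULL of `(E; a, b)` holds for all monotone `h, k` and monotone levels `0 ≤ hᵃ, hᵇ ≤ h`, `0 ≤ kᵃ, kᵇ ≤ k`, then
so does KB-MIX-FULL of `(E ∪ D; a, b)` for every decoration `D` glued at a single vertex `v`.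
[cite: KozmaNitzan2024, Questions 8–9 (§5.5 p. 36) (context)] -/
theorem coreClass_kernelMixFull_decor_allLevels (ends : ι → Sym2 V) (E D : Finset ι) (v a b : V) (hED : Disjoint E D)
    (hsep : ∀ i ∈ E, ∀ j ∈ D, ∀ w, w ∈ ends i → w ∈ ends j → w = v)
    (haD : ∀ j ∈ D, a ∈ ends j → a = v) (hbD : ∀ j ∈ D, b ∈ ends j → b = v)
    (hall : ∀ h k ha hb ka kb : Set V → ℝ, Monotone h → Monotone k → Monotone ha → Monotone hb → Monotone ka → Monotone kb →
      (∀ X, 0 ≤ ha X) → (∀ X, ha X ≤ h X) → (∀ X, 0 ≤ hb X) → (∀ X, hb X ≤ h X) →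
      (∀ X, 0 ≤ ka X) → (∀ X, ka X ≤ k X) → (∀ X, 0 ≤ kb X) → (∀ X, kb X ≤ k X) →
      0 ≤ (∑ ω ∈ E.powerset,
          h (openCluster (ends '' (↑ω : Set ι)) a ∪ openCluster (ends '' (↑ω : Set ι)) b) *
            k (openCluster (ends '' (↑ω : Set ι)) a ∪ openCluster (ends '' (↑ω : Set ι)) b))
        + ∑ ω ∈ E.powerset.filter (fun ω : Finset ι => b ∉ openCluster (ends '' (↑ω : Set ι)) a ∧ b ∉ openCluster (ends '' (↑(E \ ω) : Set ι)) a),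
          (ha (openCluster (ends '' (↑ω : Set ι)) a) - hb (openCluster (ends '' (↑(E \ ω) : Set ι)) b)) *
            (ka (openCluster (ends '' (↑ω : Set ι)) a) - kb (openCluster (ends '' (↑(E \ ω) : Set ι)) b)))
    (h k ha hb ka kb : Set V → ℝ) (hh : Monotone h) (hk : Monotone k)
    (mha : Monotone ha) (mhb : Monotone hb) (mka : Monotone ka) (mkb : Monotone kb)
    (ha0 : ∀ X, 0 ≤ ha X) (hah : ∀ X, ha X ≤ h X) (hb0 : ∀ X, 0 ≤ hb X) (hbh : ∀ X, hb X ≤ h X)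
    (ka0 : ∀ X, 0 ≤ ka X) (kak : ∀ X, ka X ≤ k X) (kb0 : ∀ X, 0 ≤ kb X) (kbk : ∀ X, kb X ≤ k X) :
    0 ≤ (∑ ω ∈ (E ∪ D).powerset,
        h (openCluster (ends '' (↑ω : Set ι)) a ∪ openCluster (ends '' (↑ω : Set ι)) b) *
          k (openCluster (ends '' (↑ω : Set ι)) a ∪ openCluster (ends '' (↑ω : Set ι)) b))
      + ∑ ω ∈ (E ∪ D).powerset.filter (fun ω : Finset ι => b ∉ openCluster (ends '' (↑ω : Set ι)) a ∧
            b ∉ openCluster (ends '' (↑((E ∪ D) \ ω) : Set ι)) a),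
        (ha (openCluster (ends '' (↑ω : Set ι)) a) - hb (openCluster (ends '' (↑((E ∪ D) \ ω) : Set ι)) b)) *
          (ka (openCluster (ends '' (↑ω : Set ι)) a) - kb (openCluster (ends '' (↑((E ∪ D) \ ω) : Set ι)) b)) := by
  refine coreClass_kernelMixFull_decor ends E D v a b hED hsep haD hbD h k ha hb ka kb mha mhb mka mkb ?_
  intro ε _
  set X : Set V := openCluster (ends '' (↑ε : Set ι)) v with hX
  have gm := glue_mono v X
  exact hall (fun Y => h (Y ∪ {w | v ∈ Y ∧ w ∈ X})) (fun Y => k (Y ∪ {w | v ∈ Y ∧ w ∈ X}))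
    (fun Y => ha (Y ∪ {w | v ∈ Y ∧ w ∈ X})) (fun Y => hb (Y ∪ {w | v ∈ Y ∧ w ∈ X}))
    (fun Y => ka (Y ∪ {w | v ∈ Y ∧ w ∈ X})) (fun Y => kb (Y ∪ {w | v ∈ Y ∧ w ∈ X}))
    (fun Y Y' hle => hh (gm hle)) (fun Y Y' hle => hk (gm hle))
    (fun Y Y' hle => mha (gm hle)) (fun Y Y' hle => mhb (gm hle)) (fun Y Y' hle => mka (gm hle)) (fun Y Y' hle => mkb (gm hle))
    (fun Y => ha0 _) (fun Y => hah _) (fun Y => hb0 _) (fun Y => hbh _)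
    (fun Y => ka0 _) (fun Y => kak _) (fun Y => kb0 _) (fun Y => kbk _)

open Classical in
/-- **The core-class kernel of a decorated middle graph from a domination map of the core.**  `E, D` as above (decoration `D` glued at `v`), a
domination map `ψ` of `(E; a, b)` (injective on the wall event, `ψ ω ⊆ E`, `C_a ω ∪ C_b(E∖ω) ⊆ C_a(ψω) ∪ C_b(ψω)`).  Then for every monotone `f` with
`f ∅ = 0` and monotone `g`, writing `E' = E ∪ D`:
`0 ≤ Σ_{ω ⊆ E'} f(C_a ∪ C_b)(g(C_a ∪ C_b) − g ∅) + Σ_{ω : b ∉ C_a ω, b ∉ C_a(E'∖ω)} [f(C_a ω)(g(C_a ω) − g(C_b(E'∖ω))) + f(C_b ω)(g(C_b ω) − g(C_a(E'∖ω)))]`.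
[cite: KozmaNitzan2024, Questions 8–9 (§5.5 p. 36) (context)] -/
theorem coreClass_kernel_nonneg_decor_of_dom (ends : ι → Sym2 V) (E D : Finset ι) (v a b : V) (hED : Disjoint E D)
    (hsep : ∀ i ∈ E, ∀ j ∈ D, ∀ w, w ∈ ends i → w ∈ ends j → w = v)
    (haD : ∀ j ∈ D, a ∈ ends j → a = v) (hbD : ∀ j ∈ D, b ∈ ends j → b = v)
    (ψ : Finset ι → Finset ι)
    (hψE : ∀ ω, ω ⊆ E → b ∉ openCluster (ends '' (↑ω : Set ι)) a → b ∉ openCluster (ends '' (↑(E \ ω) : Set ι)) a → ψ ω ⊆ E)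
    (hψcov : ∀ ω, ω ⊆ E → b ∉ openCluster (ends '' (↑ω : Set ι)) a → b ∉ openCluster (ends '' (↑(E \ ω) : Set ι)) a →
      openCluster (ends '' (↑ω : Set ι)) a ∪ openCluster (ends '' (↑(E \ ω) : Set ι)) b ⊆
        openCluster (ends '' (↑(ψ ω) : Set ι)) a ∪ openCluster (ends '' (↑(ψ ω) : Set ι)) b)
    (hψinj : ∀ ω₁ ω₂, ω₁ ⊆ E → b ∉ openCluster (ends '' (↑ω₁ : Set ι)) a → b ∉ openCluster (ends '' (↑(E \ ω₁) : Set ι)) a →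
      ω₂ ⊆ E → b ∉ openCluster (ends '' (↑ω₂ : Set ι)) a → b ∉ openCluster (ends '' (↑(E \ ω₂) : Set ι)) a → ψ ω₁ = ψ ω₂ → ω₁ = ω₂)
    (f g : Set V → ℝ) (hf : Monotone f) (hf0 : f ∅ = 0) (hg : Monotone g) :
    0 ≤ (∑ ω ∈ (E ∪ D).powerset,
        f (openCluster (ends '' (↑ω : Set ι)) a ∪ openCluster (ends '' (↑ω : Set ι)) b) *
          (g (openCluster (ends '' (↑ω : Set ι)) a ∪ openCluster (ends '' (↑ω : Set ι)) b) - g ∅))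
      + ∑ ω ∈ (E ∪ D).powerset.filter (fun ω : Finset ι => b ∉ openCluster (ends '' (↑ω : Set ι)) a ∧
            b ∉ openCluster (ends '' (↑((E ∪ D) \ ω) : Set ι)) a),
        (f (openCluster (ends '' (↑ω : Set ι)) a) *
            (g (openCluster (ends '' (↑ω : Set ι)) a) - g (openCluster (ends '' (↑((E ∪ D) \ ω) : Set ι)) b))
          + f (openCluster (ends '' (↑ω : Set ι)) b) *
            (g (openCluster (ends '' (↑ω : Set ι)) b) - g (openCluster (ends '' (↑((E ∪ D) \ ω) : Set ι)) a))) := by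
  set C : Finset ι → V → Set V := fun ω x => openCluster (ends '' (↑ω : Set ι)) x with hC
  set E' : Finset ι := E ∪ D with hE'
  have hf_nonneg : ∀ X : Set V, 0 ≤ f X := fun X => by rw [← hf0]; exact hf (Set.empty_subset X)
  have hg' : Monotone (fun X : Set V => g X - g ∅) := fun X Y hXY => sub_le_sub_right (hg hXY) _
  have hg0 : ∀ X : Set V, 0 ≤ g X - g ∅ := fun X => sub_nonneg.mpr (hg (Set.empty_subset X))
  have s1 : 0 ≤ (∑ ω ∈ E'.powerset, f (C ω a ∪ C ω b) * (g (C ω a ∪ C ω b) - g ∅))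
      + ∑ ω ∈ E'.powerset.filter (fun ω : Finset ι => b ∉ C ω a ∧ b ∉ C (E' \ ω) a),
        (f (C ω a) - f (C (E' \ ω) b)) * ((g (C ω a) - g ∅) - (g (C (E' \ ω) b) - g ∅)) :=
    coreClass_kernelMixFull_decor_allLevels ends E D v a b hED hsep haD hbD
      (fun h k ha hb ka kb hh hk _ _ _ _ ha0 hah hb0 hbh ka0 kak kb0 kbk =>
        coreClass_kernelMixFull_of_dom ends E a b h k ha hb ka kb hh hk ha0 hah hb0 hbh ka0 kak kb0 kbk ψ hψE hψcov hψinj)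
      f (fun X : Set V => g X - g ∅) f f (fun X : Set V => g X - g ∅) (fun X : Set V => g X - g ∅) hf hg' hf hf hg' hg'
      hf_nonneg (fun X => le_refl _) hf_nonneg (fun X => le_refl _) hg0 (fun X => le_refl _) hg0 (fun X => le_refl _)
  exact coreClass_kernel_nonneg_of_kernelMixFull ends E' a b f g s1

open Classical in
/-- **CW-PA on the core class over a decorated middle graph.**  Core-class bookkeeping for the middle graph `E_H = E ∪ D` (terminals `a, b` joined to
`x, z` by `ixa, ixb, iza, izb`; no edge of `E_H` at `x, z`), where `D` is a decoration of `E` glued at one vertex `v` and `(E; a, b)` carries a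
domination map `ψ`.  Then for all monotone `f, g`: `0 ≤ Σ_{s ⊆ E₀ : z ∉ C_x(s), z ∉ C_x(E₀∖s)} f(C_x s)·(g(C_x s) − g(C_x(E₀∖s)))`.
[cite: KozmaNitzan2024, Questions 8–9 (§5.5 p. 36) (context)] -/
theorem cwpa_coreClass_of_dom_decor (ends : ι → Sym2 V) (E D E₀ : Finset ι) (x z v a b : V) (ixa ixb iza izb : ι) (hED : Disjoint E D)
    (hsep : ∀ i ∈ E, ∀ j ∈ D, ∀ w, w ∈ ends i → w ∈ ends j → w = v)
    (haD : ∀ j ∈ D, a ∈ ends j → a = v) (hbD : ∀ j ∈ D, b ∈ ends j → b = v)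
    (hxa : ends ixa = s(x, a)) (hxb : ends ixb = s(x, b)) (hza : ends iza = s(z, a)) (hzb : ends izb = s(z, b))
    (hH : ∀ i ∈ E ∪ D, x ∉ ends i ∧ z ∉ ends i) (hE₀ : ∀ i, i ∈ E₀ ↔ i ∈ E ∪ D ∨ i = ixa ∨ i = ixb ∨ i = iza ∨ i = izb)
    (hnot : ixa ∉ E ∪ D ∧ ixb ∉ E ∪ D ∧ iza ∉ E ∪ D ∧ izb ∉ E ∪ D)
    (hd : ixa ≠ ixb ∧ ixa ≠ iza ∧ ixa ≠ izb ∧ ixb ≠ iza ∧ ixb ≠ izb ∧ iza ≠ izb)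
    (hxz : x ≠ z) (hxa' : x ≠ a) (hxb' : x ≠ b) (hza' : z ≠ a) (hzb' : z ≠ b)
    (ψ : Finset ι → Finset ι)
    (hψE : ∀ ω, ω ⊆ E → b ∉ openCluster (ends '' (↑ω : Set ι)) a → b ∉ openCluster (ends '' (↑(E \ ω) : Set ι)) a → ψ ω ⊆ E)
    (hψcov : ∀ ω, ω ⊆ E → b ∉ openCluster (ends '' (↑ω : Set ι)) a → b ∉ openCluster (ends '' (↑(E \ ω) : Set ι)) a →
      openCluster (ends '' (↑ω : Set ι)) a ∪ openCluster (ends '' (↑(E \ ω) : Set ι)) b ⊆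
        openCluster (ends '' (↑(ψ ω) : Set ι)) a ∪ openCluster (ends '' (↑(ψ ω) : Set ι)) b)
    (hψinj : ∀ ω₁ ω₂, ω₁ ⊆ E → b ∉ openCluster (ends '' (↑ω₁ : Set ι)) a → b ∉ openCluster (ends '' (↑(E \ ω₁) : Set ι)) a →
      ω₂ ⊆ E → b ∉ openCluster (ends '' (↑ω₂ : Set ι)) a → b ∉ openCluster (ends '' (↑(E \ ω₂) : Set ι)) a → ψ ω₁ = ψ ω₂ → ω₁ = ω₂)
    (f g : Set V → ℝ) (hf : Monotone f) (hg : Monotone g) :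
    0 ≤ ∑ s ∈ E₀.powerset.filter (fun s : Finset ι => z ∉ openCluster (ends '' (↑s : Set ι)) x ∧ z ∉ openCluster (ends '' (↑(E₀ \ s) : Set ι)) x),
      f (openCluster (ends '' (↑s : Set ι)) x) * (g (openCluster (ends '' (↑s : Set ι)) x) - g (openCluster (ends '' (↑(E₀ \ s) : Set ι)) x)) :=
  cwpa_coreClass_of_kernel ends (E ∪ D) E₀ x z a b ixa ixb iza izb hxa hxb hza hzb hH hE₀ hnot hd hxz hxa' hxb' hza' hzb'
    (fun f' g' hf' hf0' hg' => coreClass_kernel_nonneg_decor_of_dom ends E D v a b hED hsep haD hbD ψ hψE hψcov hψinj f' g' hf' hf0' hg')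
    f g hf hg

end Coefficientwise

end Summit.CriticalPhenomena.PercolationContinuityZ3.Theorems
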